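import Literature.AlgebraicGeometry.Resolution.DChartModel
import Literature.AlgebraicGeometry.Resolution.SplitDiscNewton
import Literature.AlgebraicGeometry.Resolution.EChart
import HarnessLib

/-!
# The roof datum of the level-wise construction for Temkin's Thm. 3.3.1 — I. Setup

Topic: `Literature/AlgebraicGeometry/Resolution`. M. Temkin, *Inseparable local uniformization*,
J. Algebra 373 (2013) = arXiv:0804.1554v3, Thm. 3.3.1, smooth-fibre case (tree: the named fact
`Temkin2013RelativeCurveSmoothFibre`, the last leaf of `Temkin2013`). The chart datum
`RelCurveChart` (`RelativeCurveChartSetup.lean`) of the first algebraization attempt cannot be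
instantiated from the hypotheses of the leaf: it keeps ONE constant field `m = k(y₀)` separable
over the ground field `k` of the leaf and asks for the deep disc to be `m`-rational, which fails
before a purely inseparable extension of `k` (e.g. `k = 𝔽_p(u)((t))`-like, `x = u^{1/p} + w`),
and it leaves the `K`-rational cut-out of the disc to an interface (`hbmemZ`, `hbcutZ`) that has
no construction when `K₁ ≠ K`. The level-wise construction (design notes `DESIGN-J2-v2` of the
`Temkin2013` unit) works at a finite purely inseparable LEVEL of the ground field, where

* the constants are `m = k(y₀, a)`: the henselian constants `y₀` (with an approximant `ya` from
  the function field chosen BEFORE the disc) and the deep Krasner-split centre `a` of the disc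
  (Temkin, Thm. 3.2.6 Step 2; tree: `GeneratorDeepCentres.lean`, `DeepDiscFiniteLevel.lean`),
  realized on the `K`-side by TWO stacked Hensel charts — `y₀` through the zoomed polynomial of
  `(P₀, ya, β)` (`HenselChartInField.lean`), then the disc coordinate `x′ = (x − a)/c` through its
  Hensel polynomial `H(S) = P(x − cS)/(−cP′(x))` (`SplitDiscNewton.lean`,
  `EtaleChartOfRoot.lean`), whence `a = x − c x′`;
* every element of the function field needed on the `K`-side is placed in the localization
  `N[1/s]` of the normalization `N = Nr_{K₁}(A′)` at ONE separating unit `s`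
  (`SeparatingUnit.lean`, `PlacementBySeparatingUnit.lean`), the model having been refined by
  explicit minimal-polynomial coefficients (`ConjugateBoundCoefficients.lean`) — this replaces the
  cut-out interface.

This file fixes the DATUM of that construction (all choices already made; the valuation theory
that makes them possible is the business of the driver) and its first API: the base ring
`N″ = N[1/s] ⊆ O_V` of the `K`-side charts.

* `discHenselPoly` — the Hensel polynomial `H` of the disc coordinate (the `let H` of
  `SplitDiscNewton.henselPoly_discCoordinate`, as a definition);
* `RoofDatum` — the datum (a structure: data and hypotheses, no constructions);
* `RoofDatum.N`, `.N''`, `.m`, `.Om`, `.x'` and their API: `N ⊆ K₁°`, `Frac N = K₁`, `N` and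
  `N″` integrally closed, `N″ ⊆ O_V`, `N″` smooth over `N`, the placed elements `x, ya, β` and the
  coefficients of `H` lie in `N″`, `m = k(y₀, a)` is finite separable over `k` — PROVED.

Everything is [folklore] bookkeeping over the cited files; no named facts.

## Sources

* M. Temkin, arXiv:0804.1554v3, proof of Thm. 3.3.1, Steps 2–4 (pp. 44–45); Thm. 3.2.6, proof,
  Step 2 (p. 43). [Temkin2013]
-/

noncomputable section

open Polynomial IsLocalRing

namespace Literature.AlgebraicGeometry.Resolution

universe u

/-- **The Hensel polynomial of the disc coordinate**: for `P` over `Ω`, a scaling constant `c`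
and a point `x` of the disc, `H(S) = P(x − cS) · (−c·P′(x))⁻¹` (normalised by its linear
coefficient; `SplitDiscNewton.henselPoly_discCoordinate` proves `H(x′) = 0`, `|H′(x′)| = 1`, all
coefficients of value `≤ 1`, for `x′ = (x − a)/c` on a split disc centred at a simple root `a`
of `P`). [cite: Temkin2013, Lemma 3.1.3 with Thm. 3.3.1 (proof, Step 3)] -/
def discHenselPoly {Ω : Type u} [Field Ω] (PΩ : Polynomial Ω) (c x : Ω) : Polynomial Ω :=
  PΩ.comp (C x - C c * X) * C (-c * (derivative PΩ).eval x)⁻¹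

/-- Unfolding `discHenselPoly`. [folklore] -/
theorem discHenselPoly_def {Ω : Type u} [Field Ω] (PΩ : Polynomial Ω) (c x : Ω) :
    discHenselPoly PΩ c x = PΩ.comp (C x - C c * X) * C (-c * (derivative PΩ).eval x)⁻¹ := rfl

/-- **The roof datum** of the level-wise construction for Thm. 3.3.1 (smooth-fibre case), for
valued fields `k ⊆ K ⊆ K₁` (here `L₁` is the leaf's `K₁`) inside an ambient valued field
`(Ω, V)`: the model `A′ ≥ A`, the separating unit `s ∈ N = Nr_{K₁}(A′)` with the exponent `M`,
the data of the first Hensel chart (`y₀`, `P₀ ∈ k°[X]`, the approximant `ya` and the Newton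
quotient `β`, placed as `ya sᴹ, β sᴹ ∈ N`), the data of the second Hensel chart (the
Krasner-split disc `(a, c)`, `P ∈ k[X]` with the simple root `a`, the point `x ∈ K₁` of the disc
placed as `x sᴹ ∈ N`, the coefficients of `H` placed likewise), and the part of the `m°`-side
chart needed on the `K`-side (the unit-form product `u_E ∈ m°[x′]`, the monic `f` over
`m°[x′][1/u_E]` with its root `η ∈ O_V`, and a fraction form of `η` over `N[y₀, a]`). See the
module docstring. [cite: Temkin2013, Thm. 3.3.1 (proof, Steps 2–4)] -/
structure RoofDatum (k K L₁ Ω : Type u) [Field k] [Field K] [Field L₁] [Field Ω]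
    [Algebra k K] [Algebra K L₁] [Algebra k L₁] [IsScalarTower k K L₁]
    [Algebra L₁ Ω] [Algebra k Ω] [IsScalarTower k L₁ Ω] [FiniteDimensional K L₁] where
  /-- `k°`. -/
  Ok : ValuationSubring k
  /-- `K°`. -/
  O : ValuationSubring K
  /-- `K₁°`. -/
  O₁ : ValuationSubring L₁
  /-- The ambient valuation ring, inducing `K₁°`. -/
  V : ValuationSubring Ω
  hV : V.comap (algebraMap L₁ Ω) = O₁
  hO₁ : O₁.comap (algebraMap K L₁) = O
  hO : O.comap (algebraMap k K) = Ok
  /-- `k°` has height one. -/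
  hdimk : ringKrullDim Ok = 1
  /-- The affine normalized model `A′ ≥ A` of `K°` over `k°`. -/
  A : Subring K
  A' : Subring K
  hAA' : A ≤ A'
  hA' : IsAffineNormalizedModel O (Ok.toSubring.map (algebraMap k K)) A'
  /-- The separating unit `s ∈ N = Nr_{K₁}(A′)`, a unit of `O_V`, and the placement exponent. -/
  s : L₁
  hsN : s ∈ nrIn (A'.map (algebraMap K L₁))
  hvs : V.valuation (algebraMap L₁ Ω s) = 1
  M : ℕ
  /-- First Hensel chart: the constant `y₀`, a simple root of `P₀ ∈ k°[X]`, separable over `k`. -/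
  y₀ : Ω
  P₀ : Polynomial k
  hP₀coef : ∀ i, P₀.coeff i ∈ Ok
  hy₀ : aeval y₀ P₀ = 0
  hy₀' : aeval y₀ (derivative P₀) ≠ 0
  hy₀int : IsIntegral k y₀
  hy₀sep : IsSeparable k y₀
  /-- The approximant `ya ∈ K₁` of `y₀` and the Newton quotient `β`, placed in `N[1/s]`, with
  `P₀(ya) = P₀′(ya)² β`, `P₀′(ya) ≠ 0` and the Newton condition `|y₀ − ya| < |P₀′(ya)|`. -/
  ya : L₁
  β : L₁
  hyaN : ya * s ^ M ∈ nrIn (A'.map (algebraMap K L₁))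
  hβN : β * s ^ M ∈ nrIn (A'.map (algebraMap K L₁))
  hNewton : aeval ya P₀ = aeval ya (derivative P₀) ^ 2 * β
  hya' : aeval ya (derivative P₀) ≠ 0
  hclose : V.valuation (y₀ - algebraMap L₁ Ω ya) <
    V.valuation (algebraMap L₁ Ω (aeval ya (derivative P₀)))
  /-- Second Hensel chart: the Krasner-split disc `|X − a| ≤ |c|` (`a` a simple root of
  `P ∈ k[X]`, separable algebraic over `k`, every other root at distance `> |c|`, `c ∈ k ∖ 0`)
  through the point `x ∈ K₁`, placed in `N[1/s]`. -/
  a : Ω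
  haint : IsIntegral k a
  hasep : IsSeparable k a
  c : k
  hc0 : c ≠ 0
  hcO : c ∈ Ok
  P : Polynomial k
  hPa : aeval a P = 0
  hPa' : aeval a (derivative P) ≠ 0
  hfar : ∀ ρ : Ω, aeval ρ P = 0 → ρ ≠ a → V.valuation (algebraMap k Ω c) < V.valuation (a - ρ)
  x : L₁
  hxN : x * s ^ M ∈ nrIn (A'.map (algebraMap K L₁))
  hxa : V.valuation (algebraMap L₁ Ω x - a) ≤ V.valuation (algebraMap k Ω c)
  /-- The coefficients of the Hensel polynomial `H` of the disc coordinate are placed in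
  `N[1/s]`. -/
  hH : ∀ j, ∃ h : L₁, algebraMap L₁ Ω h =
      (discHenselPoly (P.map (algebraMap k Ω)) (algebraMap k Ω c) (algebraMap L₁ Ω x)).coeff j ∧
    h * s ^ M ∈ nrIn (A'.map (algebraMap K L₁))
  /-- The part of the `m°`-side chart entering the `K`-side: the unit-form product
  `u_E ∈ m°[x′]`, `m = k(y₀, a)`, a unit of `O_V`; the monic `f` over `m°[x′][1/u_E]` with its
  root `η ∈ O_V`; and a fraction form of `η` over `N[y₀, a]`. -/
  uE : Ω
  hvuE : V.valuation uE = 1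
  huE : uE ∈ Algebra.adjoin
    (V.toSubring ⊓ (IntermediateField.adjoin k ({y₀, a} : Set Ω)).toSubfield.toSubring : Subring Ω)
    ({(algebraMap L₁ Ω x - a) / algebraMap k Ω c} : Set Ω)
  f : Polynomial Ω
  hfmon : f.Monic
  hfcoef : ∀ i, f.coeff i ∈ locAway (Algebra.adjoin
    (V.toSubring ⊓ (IntermediateField.adjoin k ({y₀, a} : Set Ω)).toSubfield.toSubring : Subring Ω)
    ({(algebraMap L₁ Ω x - a) / algebraMap k Ω c} : Set Ω)) uE huE
  η : Ω
  hηV : η ∈ V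
  hfη : f.eval η = 0
  hηfrac : ∃ n ∈ nrIn (A'.map (algebraMap K L₁)), n ≠ 0 ∧
    algebraMap L₁ Ω n * η ∈ Algebra.adjoin (nrIn (A'.map (algebraMap K L₁))) ({y₀, a} : Set Ω)

namespace RoofDatum

variable {k K L₁ Ω : Type u} [Field k] [Field K] [Field L₁] [Field Ω]
  [Algebra k K] [Algebra K L₁] [Algebra k L₁] [IsScalarTower k K L₁]
  [Algebra L₁ Ω] [Algebra k Ω] [IsScalarTower k L₁ Ω] [FiniteDimensional K L₁]
  (D : RoofDatum k K L₁ Ω)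

/-! ### The model and its normalization `N` -/

/-- `N = Nr_{K₁}(A′)`. [folklore] -/
def N : Subring L₁ := nrIn (D.A'.map (algebraMap K L₁))

/-- Unfolding `N`. [folklore] -/
theorem N_def : D.N = nrIn (D.A'.map (algebraMap K L₁)) := rfl

/-- `k° ↦ K°`. [folklore] -/
theorem R₀_le_O : D.Ok.toSubring.map (algebraMap k K) ≤ D.O.toSubring := by
  rintro _ ⟨c₀, hc₀, rfl⟩
  have : c₀ ∈ D.O.comap (algebraMap k K) := by rw [D.hO]; exact hc₀
  exact this

/-- `A′ ⊆ K°`. [folklore] -/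
theorem A'_le_O : D.A' ≤ D.O.toSubring := (D.hA'.le_and_le D.R₀_le_O).1

/-- `k° ⊆ A′`. [folklore] -/
theorem R₀_le_A' : D.Ok.toSubring.map (algebraMap k K) ≤ D.A' := (D.hA'.le_and_le D.R₀_le_O).2

/-- `N ⊆ K₁°`. [folklore] -/
theorem N_le_O₁ : D.N ≤ D.O₁.toSubring := nrIn_map_le_valuationSubring D.A'_le_O D.O₁ D.hO₁

/-- `A′ ↦ N`. [folklore] -/
theorem algebraMap_mem_N {w : K} (hw : w ∈ D.A') : algebraMap K L₁ w ∈ D.N :=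
  le_nrIn _ (Subring.mem_map.mpr ⟨w, hw, rfl⟩)

/-- `k° ↦ N`. [folklore] -/
theorem algebraMap_mem_N_of_mem_Ok {c₀ : k} (hc₀ : c₀ ∈ D.Ok) : algebraMap k L₁ c₀ ∈ D.N := by
  rw [IsScalarTower.algebraMap_apply k K L₁]
  exact D.algebraMap_mem_N (D.R₀_le_A' (Subring.mem_map.mpr ⟨c₀, hc₀, rfl⟩))

/-- `Frac N = K₁`. [folklore] -/
theorem exists_div_N (z : L₁) : ∃ a ∈ D.N, ∃ b ∈ D.N, b ≠ 0 ∧ z = a / b := by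
  obtain ⟨s, -, -, hfr⟩ := D.hA'
  exact exists_div_nrIn D.A' hfr z

/-- `N` is integrally closed. [folklore] -/
theorem isIntegrallyClosed_N : IsIntegrallyClosed D.N :=
  isIntegrallyClosed_nrIn _ fun z => by
    obtain ⟨a, ha, b, hb, -, h⟩ := D.exists_div_N z
    exact ⟨a, ha, b, hb, h⟩

/-- Common `N`-denominators for finitely many elements of `K₁`. [folklore] -/
theorem exists_mul_mem_N (S : Finset L₁) : ∃ n ∈ D.N, n ≠ 0 ∧ ∀ z ∈ S, n * z ∈ D.N := by
  classical
  induction S using Finset.induction_on with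
  | empty => exact ⟨1, D.N.one_mem, one_ne_zero, fun z hz => absurd hz (Finset.notMem_empty z)⟩
  | @insert w S _ ih =>
    obtain ⟨n, hnN, hn0, hnS⟩ := ih
    obtain ⟨a, ha, b, hb, hb0, hw'⟩ := D.exists_div_N w
    refine ⟨n * b, D.N.mul_mem hnN hb, mul_ne_zero hn0 hb0, fun z hz => ?_⟩
    rcases Finset.mem_insert.mp hz with rfl | hz
    · rw [hw', mul_assoc, mul_div_cancel₀ _ hb0]
      exact D.N.mul_mem hnN ha
    · rw [mul_comm n b, mul_assoc]
      exact D.N.mul_mem hb (hnS z hz)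

/-- `N → Ω` is injective. [folklore] -/
theorem algebraMap_N_injective : Function.Injective (algebraMap D.N Ω) :=
  (algebraMap L₁ Ω).injective.comp Subtype.val_injective

/-- The valuation ring induced by `V` on `k` is `k°`. [folklore] -/
theorem comap_k : D.V.comap (algebraMap k Ω) = D.Ok := by
  rw [IsScalarTower.algebraMap_eq k L₁ Ω, IsScalarTower.algebraMap_eq k K L₁,
    ← ValuationSubring.comap_comap, ← ValuationSubring.comap_comap, D.hV, D.hO₁, D.hO]

/-- `k° ↦ O_V`. [folklore] -/
theorem algebraMap_mem_V_of_mem_Ok {c₀ : k} (hc₀ : c₀ ∈ D.Ok) : algebraMap k Ω c₀ ∈ D.V := by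
  have : c₀ ∈ D.V.comap (algebraMap k Ω) := by rw [D.comap_k]; exact hc₀
  exact this

/-- `N ↦ O_V`. [folklore] -/
theorem algebraMap_mem_V_of_mem_N {w : L₁} (hw : w ∈ D.N) : algebraMap L₁ Ω w ∈ D.V := by
  have : w ∈ D.V.comap (algebraMap L₁ Ω) := by rw [D.hV]; exact D.N_le_O₁ hw
  exact this

/-! ### The separating unit and the base ring `N″ = N[1/s] ⊆ Ω` -/

/-- `s` in `Ω`. [folklore] -/
def sΩ : Ω := algebraMap L₁ Ω D.s

/-- `s ≠ 0`. [folklore] -/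
theorem s_ne_zero : D.s ≠ 0 := fun h0 => by
  have h := D.hvs
  rw [h0, map_zero, map_zero] at h
  exact zero_ne_one h

/-- `sΩ ≠ 0`. [folklore] -/
theorem sΩ_ne_zero : D.sΩ ≠ 0 := (_root_.map_ne_zero _).mpr D.s_ne_zero

/-- `|sΩ| = 1`. [folklore] -/
theorem valuation_sΩ : D.V.valuation D.sΩ = 1 := D.hvs

/-- `sΩ` lies in the image `⊥` of `N` in `Ω`. [folklore] -/
theorem sΩ_mem_bot : D.sΩ ∈ (⊥ : Subalgebra D.N Ω) :=
  Algebra.mem_bot.mpr ⟨⟨D.s, D.hsN⟩, rfl⟩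

/-- **The base ring `N″ = N[1/s] ⊆ Ω`** of the `K`-side charts. [folklore] -/
def N'' : Subalgebra D.N Ω := locAway (⊥ : Subalgebra D.N Ω) D.sΩ D.sΩ_mem_bot

/-- `N″` is smooth over `N`. [folklore] -/
theorem smooth_N'' : Algebra.Smooth D.N D.N'' := by
  haveI : Algebra.Smooth D.N D.N := ⟨inferInstance, inferInstance⟩
  haveI : Algebra.Smooth D.N (⊥ : Subalgebra D.N Ω) :=
    Algebra.Smooth.of_equiv (Algebra.botEquivOfInjective D.algebraMap_N_injective).symm
  exact smooth_locAway_of_smooth D.sΩ_ne_zero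

/-- `⊥ ⊆ V`. [folklore] -/
theorem bot_le_V : (⊥ : Subalgebra D.N Ω).toSubring ≤ D.V.toSubring := by
  intro w hw
  obtain ⟨⟨n, hn⟩, rfl⟩ := Algebra.mem_bot.mp hw
  exact D.algebraMap_mem_V_of_mem_N hn

/-- `N″ ⊆ O_V`. [folklore] -/
theorem N''_le_V : D.N''.toSubring ≤ D.V.toSubring :=
  locAway_le_valuationSubring D.bot_le_V D.valuation_sΩ

/-- `N″ → O_V` elementwise. [folklore] -/
theorem algebraMap_N''_mem_V (r : D.N'') : algebraMap D.N'' Ω r ∈ D.V := D.N''_le_V r.2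

/-- `N″` is integrally closed. [folklore] -/
theorem isIntegrallyClosed_N'' : IsIntegrallyClosed D.N'' := by
  change IsIntegrallyClosed (locAway (⊥ : Subalgebra D.N Ω) D.sΩ D.sΩ_mem_bot)
  haveI : IsIntegrallyClosed D.N := D.isIntegrallyClosed_N
  haveI : IsIntegrallyClosed (⊥ : Subalgebra D.N Ω) :=
    IsIntegrallyClosed.of_equiv
      (Algebra.botEquivOfInjective D.algebraMap_N_injective).symm.toRingEquiv
  exact isIntegrallyClosed_locAway D.sΩ_ne_zero

/-- `sΩ⁻¹ ∈ N″`. [folklore] -/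
theorem sΩ_inv_mem : D.sΩ⁻¹ ∈ D.N'' := inv_mem_locAway D.sΩ_ne_zero

/-- `N ↦ N″`. [folklore] -/
theorem algebraMap_mem_N'' {w : L₁} (hw : w ∈ D.N) : algebraMap L₁ Ω w ∈ D.N'' :=
  le_locAway (Algebra.mem_bot.mpr ⟨⟨w, hw⟩, rfl⟩)

/-- `k° ↦ N″`. [folklore] -/
theorem algebraMap_mem_N''_of_mem_Ok {c₀ : k} (hc₀ : c₀ ∈ D.Ok) : algebraMap k Ω c₀ ∈ D.N'' := by
  rw [IsScalarTower.algebraMap_apply k L₁ Ω]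
  exact D.algebraMap_mem_N'' (D.algebraMap_mem_N_of_mem_Ok hc₀)

/-- **Placed elements lie in `N″`**: if `w sᴹ ∈ N` then `w ∈ N″ = N[1/s]`. [folklore] -/
theorem algebraMap_mem_N''_of_mul_pow_mem {w : L₁} {M' : ℕ} (hw : w * D.s ^ M' ∈ D.N) :
    algebraMap L₁ Ω w ∈ D.N'' := by
  refine ⟨M', ?_⟩
  change algebraMap L₁ Ω w * algebraMap L₁ Ω D.s ^ M' ∈ (⊥ : Subalgebra D.N Ω)
  rw [← map_pow, ← map_mul]
  exact Algebra.mem_bot.mpr ⟨⟨_, hw⟩, rfl⟩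

/-- `x ↦ N″`. [folklore] -/
theorem xΩ_mem_N'' : algebraMap L₁ Ω D.x ∈ D.N'' := D.algebraMap_mem_N''_of_mul_pow_mem D.hxN

/-- `ya ↦ N″`. [folklore] -/
theorem yaΩ_mem_N'' : algebraMap L₁ Ω D.ya ∈ D.N'' := D.algebraMap_mem_N''_of_mul_pow_mem D.hyaN

/-- `β ↦ N″`. [folklore] -/
theorem βΩ_mem_N'' : algebraMap L₁ Ω D.β ∈ D.N'' := D.algebraMap_mem_N''_of_mul_pow_mem D.hβN

/-- The coefficients of `H` lie in `N″`. [folklore] -/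
theorem coeff_H_mem_N'' (j : ℕ) :
    (discHenselPoly (D.P.map (algebraMap k Ω)) (algebraMap k Ω D.c) (algebraMap L₁ Ω D.x)).coeff j
      ∈ D.N'' := by
  obtain ⟨h, hh, hhN⟩ := D.hH j
  rw [← hh]
  exact D.algebraMap_mem_N''_of_mul_pow_mem hhN

/-! ### The constants `m = k(y₀, a)` and the disc coordinate -/

/-- The constant field `m = k(y₀, a) ⊆ Ω`. [folklore] -/
def m : IntermediateField k Ω := IntermediateField.adjoin k ({D.y₀, D.a} : Set Ω)

/-- Unfolding `m`. [folklore] -/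
theorem m_def : D.m = IntermediateField.adjoin k ({D.y₀, D.a} : Set Ω) := rfl

/-- `y₀ ∈ m`. [folklore] -/
theorem y₀_mem_m : D.y₀ ∈ D.m := IntermediateField.subset_adjoin k _ (Set.mem_insert _ _)

/-- `a ∈ m`. [folklore] -/
theorem a_mem_m : D.a ∈ D.m :=
  IntermediateField.subset_adjoin k _ (Set.mem_insert_of_mem _ (Set.mem_singleton _))

/-- `k ↦ m`. [folklore] -/
theorem algebraMap_mem_m (c₀ : k) : algebraMap k Ω c₀ ∈ D.m := D.m.algebraMap_mem c₀

/-- `m` is finite over `k`. [folklore] -/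
instance finiteDimensional_m : FiniteDimensional k D.m := by
  change FiniteDimensional k (IntermediateField.adjoin k ({D.y₀, D.a} : Set Ω))
  refine IntermediateField.finiteDimensional_adjoin fun z hz => ?_
  rcases hz with rfl | hz
  · exact D.hy₀int
  · rw [Set.mem_singleton_iff.mp hz]; exact D.haint

/-- `m` is separable over `k`. [folklore] -/
instance isSeparable_m : Algebra.IsSeparable k D.m := by
  change Algebra.IsSeparable k (IntermediateField.adjoin k ({D.y₀, D.a} : Set Ω))
  rw [IntermediateField.isSeparable_adjoin_iff_isSeparable]
  intro z hz
  rcases hz with rfl | hz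
  · exact D.hy₀sep
  · rw [Set.mem_singleton_iff.mp hz]; exact D.hasep

/-- The valuation ring `m° = O_V ∩ m`, as a subring of `Ω`. [folklore] -/
def Om : Subring Ω := D.V.toSubring ⊓ D.m.toSubfield.toSubring

/-- Membership in `Om`. [folklore] -/
theorem mem_Om_iff {z : Ω} : z ∈ D.Om ↔ z ∈ D.V ∧ z ∈ D.m := Subring.mem_inf

/-- `c` in `Ω`. [folklore] -/
def cΩ : Ω := algebraMap k Ω D.c

/-- `cΩ ≠ 0`. [folklore] -/
theorem cΩ_ne_zero : D.cΩ ≠ 0 := (_root_.map_ne_zero _).mpr D.hc0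

/-- `cΩ ∈ N″`. [folklore] -/
theorem cΩ_mem_N'' : D.cΩ ∈ D.N'' := D.algebraMap_mem_N''_of_mem_Ok D.hcO

/-- `cΩ ∈ O_V`. [folklore] -/
theorem cΩ_mem_V : D.cΩ ∈ D.V := D.algebraMap_mem_V_of_mem_Ok D.hcO

/-- `x` in `Ω`. [folklore] -/
def xΩ : Ω := algebraMap L₁ Ω D.x

/-- The disc coordinate `x′ = (x − a)/c`. [folklore] -/
def x' : Ω := (D.xΩ - D.a) / D.cΩ

/-- Unfolding `x′`. [folklore] -/
theorem x'_def : D.x' = (algebraMap L₁ Ω D.x - D.a) / algebraMap k Ω D.c := rfl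

/-- `x′ ∈ O_V`. [folklore] -/
theorem x'_mem_V : D.x' ∈ D.V := by
  rw [← D.V.valuation_le_one_iff, x'_def, map_div₀]
  exact div_le_one_of_le₀ D.hxa zero_le

/-- `a = x − c x′`. [folklore] -/
theorem a_eq : D.a = D.xΩ - D.cΩ * D.x' := by
  rw [x', mul_div_cancel₀ _ D.cΩ_ne_zero]
  ring

end RoofDatum

end Literature.AlgebraicGeometry.Resolution

end
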